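import Summits.KontsevichZagierPeriods.KontsevichZagierPeriods.Theorems.GrothendieckLemniscaticSectorGlue
import Summits.KontsevichZagierPeriods.KontsevichZagierPeriods.Theorems.MzvKernelInKZ.Negative.EulerFour
import Summits.KontsevichZagierPeriods.KontsevichZagierPeriods.Theorems.MzvKernelInKZ.Negative.PiLine
import Summits.KontsevichZagierPeriods.KontsevichZagierPeriods.Theorems.GpcZeta4Eq4zeta31.Negative.Core

/-!
# Line `sector-amalgamation` for crux `Grothendieck.SectorComplement` (stmt-KontsevichZagierPeriods-11102) — SKELETON

Lead's skeleton (reshaped from the planner's gen-2 skeleton; stubs `stub_eulerCross4`, `stub_eulerCross2`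
kept with their registered signatures, `stub_jointKernel` added as the registered landing vehicle of the glue, `stub_zeta3Disjoint` dropped from the composition — it is an open
transcendence statement (`ζ(3) ∉ ℚ[K,E,π]`-type) idle for `SectorComplement_of` — and the declared remainder
`stub_complementOfJoin` restated over the join WITHOUT the weight-3 words).

Composition: `H₁ = LemniscaticSectorKernel` ⇒ kernel form on `closure lemGen` (adapter, §3) ⇒ by the
AMALGAMATION LEMMA (§1) along the `π`-line, using the landed MZV rungs `weightKernel_four`, `weightKernelAdm_two`,
the value spans `eval (closure (genSetAdm 4)) ⊆ ℚπ⁴`, `eval (closure (genSetAdm 2)) ⊆ ℚπ²` (§2) and the two Euler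
CROSS relations (stubs, §4: `[ℝ⁴, ∏ 1/(1+xⱼ²)] ≡ 90·[Δ₄, ω₀₀₀₁]`, `[ℝ², ∏ 1/(1+xⱼ²)] ≡ 6·[Δ₂, ω₀₁]`), kernel form
holds on the JOIN `closure lemGen ⊔ closure (genSetAdm 4) ⊔ closure (genSetAdm 2)` (§5); the declared summit-strength
remainder `stub_complementOfJoin` (§6) then concludes the Statement; `SectorComplement_of` (§7) is the crux by name.
-/

noncomputable section

open MeasureTheory Set
open Literature.NumberTheory.Transcendental
open Literature.NumberTheory.Transcendental.KZ
open MvPolynomial (aeval X C)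
open Summit.KontsevichZagierPeriods.KontsevichZagierPeriods.Theses.Grothendieck
open Summit.KontsevichZagierPeriods.Grothendieck.GpcLegendreLemniscaticNegative
open Summit.KontsevichZagierPeriods.Grothendieck.LemniscaticSectorGlue
open Summit.KontsevichZagierPeriods.MzvKernelInKZ.Negative

namespace Summit.KontsevichZagierPeriods.Grothendieck.SectorComplementAmalgamation

-- `quotPrecheck` cannot see through Mathlib's set-builder binder notation; the body only uses
-- file-wide opens, so unhygienic expansion at the use sites is safe.
set_option quotPrecheck false in
/-- The generating set of the lemniscatic sector: all representations with the literal domain and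
integrand of a lemniscatic monomial of some type `(a, b, c)` (as in `LemniscaticSectorKernel`). -/
local notation "lemGen" =>
  ({g : FormalRep | ∃ (a b c : ℕ) (r : IntegralRep ((a + b) + c)),
    r.domain = {x | ∀ j : Fin (a + b), x (Fin.castAdd c j) ∈ Set.Ioo (0:ℝ) 1} ∧
    Set.EqOn r.integrand (fun x =>
      (∏ j : Fin a, (1 / Real.sqrt ((1 - x (Fin.castAdd c (Fin.castAdd b j)) ^ 2) *
        (1 - x (Fin.castAdd c (Fin.castAdd b j)) ^ 2 / 2)))) *
      (∏ j : Fin b, (Real.sqrt (1 - x (Fin.castAdd c (Fin.natAdd a j)) ^ 2 / 2) /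
        Real.sqrt (1 - x (Fin.castAdd c (Fin.natAdd a j)) ^ 2))) *
      ∏ j : Fin c, (1 / (1 + x (Fin.natAdd (a + b) j) ^ 2))) r.domain ∧
    g = KZ.of r} : Set FormalRep)

/-! ## §1 The amalgamation lemma (transfer form, kernel form on the nose) -/

/-- **AMALGAMATION LEMMA** (transfer form). If Conjecture 1 in kernel form holds on two subgroups
`A`, `B` of formal combinations, and every cross value `eval a = −eval b` (`a ∈ A`, `b ∈ B`) is, up to a
rational factor `u/v`, the value of some `γ ∈ A` which is congruent modulo `relations` to some `γ' ∈ B`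
(a "transfer" across the junction), then kernel form holds on `A ⊔ B`. Proof: `v·a − u·γ ∈ A ∩ ker eval`,
`v·b + u·γ' ∈ B ∩ ker eval`, so `v·(a+b) ∈ relations`, and `FormalRep ⧸ relations` is torsion-free
(`mem_relations_of_nsmul_mem`). [folklore] -/
theorem kernelOn_sup {A B : AddSubgroup FormalRep}
    (hA : ∀ c ∈ A, eval c = 0 → c ∈ relations) (hB : ∀ c ∈ B, eval c = 0 → c ∈ relations)
    (hX : ∀ a ∈ A, ∀ b ∈ B, eval a + eval b = 0 →
      ∃ (v : ℕ) (u : ℤ) (γ γ' : FormalRep), 0 < v ∧ γ ∈ A ∧ γ' ∈ B ∧ γ - γ' ∈ relations ∧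
        (v : ℝ) * eval a = u * eval γ) :
    ∀ c ∈ A ⊔ B, eval c = 0 → c ∈ relations := by
  intro c hc h0
  obtain ⟨a, ha, b, hb, rfl⟩ := AddSubgroup.mem_sup.mp hc
  rw [map_add] at h0
  obtain ⟨v, u, γ, γ', hv, hγ, hγ', hγγ', hval⟩ := hX a ha b hb h0
  have hγval : eval γ = eval γ' := by
    have h := relations_le_ker_eval_holds hγγ'
    rwa [AddMonoidHom.mem_ker, map_sub, sub_eq_zero] at h
  have h1mem : v • a - u • γ ∈ A := A.sub_mem (A.nsmul_mem ha v) (A.zsmul_mem hγ u)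
  have h1val : eval (v • a - u • γ) = 0 := by
    rw [map_sub, map_nsmul, map_zsmul, nsmul_eq_mul, zsmul_eq_mul]
    linear_combination hval
  have h2mem : v • b + u • γ' ∈ B := B.add_mem (B.nsmul_mem hb v) (B.zsmul_mem hγ' u)
  have h2val : eval (v • b + u • γ') = 0 := by
    rw [map_add, map_nsmul, map_zsmul, nsmul_eq_mul, zsmul_eq_mul, ← hγval]
    linear_combination (v : ℝ) * h0 - hval
  have hr1 := hA _ h1mem h1val
  have hr2 := hB _ h2mem h2val
  have key : v • (a + b) = (v • a - u • γ) + (v • b + u • γ') + u • (γ - γ') := by module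
  refine mem_relations_of_nsmul_mem hv ?_
  rw [key]
  exact relations.add_mem (relations.add_mem hr1 hr2) (relations.zsmul_mem hγγ' u)

/-! ## §2 Value spans of the MZV closures of weights 4 and 2 (no transcendence) -/

/-- Every formal combination of admissible weight-4 word representations has value in `ℚ·π⁴`
(`ζ(4), ζ(3,1), ζ(2,2), ζ(2,1,1) ∈ ℚπ⁴`, tree values). [folklore] -/
theorem exists_rat_eval_of_mem_closure_four {c : FormalRep}
    (hc : c ∈ AddSubgroup.closure (genSetAdm 4)) : ∃ q : ℚ, eval c = q * Real.pi ^ 4 := by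
  induction hc using AddSubgroup.closure_induction with
  | mem x hx =>
    obtain ⟨ε, q, s, hε, hd, hi, rfl⟩ := hx
    have h1 : s.value = (wordRep ε q hε).value := by
      have h := relations_le_ker_eval_holds (of_sub_of_wordRep_mem_relations hε s hd hi)
      rwa [AddMonoidHom.mem_ker, map_sub, sub_eq_zero, eval_of, eval_of] at h
    rw [eval_of, h1, value_wordRep]
    rcases adm_four_cases hε with rfl | rfl | rfl | rfl
    · exact ⟨q / 90, by rw [value_ω4]; push_cast; ring⟩
    · exact ⟨q / 360, by rw [value_ω31]; push_cast; ring⟩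
    · exact ⟨q / 120, by rw [value_ω22]; push_cast; ring⟩
    · exact ⟨q / 90, by rw [value_ω211]; push_cast; ring⟩
  | zero => exact ⟨0, by simp⟩
  | add x y _ _ hx hy =>
    obtain ⟨p, hp⟩ := hx
    obtain ⟨q, hq⟩ := hy
    exact ⟨p + q, by rw [map_add, hp, hq]; push_cast; ring⟩
  | neg x _ hx =>
    obtain ⟨p, hp⟩ := hx
    exact ⟨-p, by rw [map_neg, hp]; push_cast; ring⟩

/-- Every formal combination of admissible weight-2 word representations has value in `ℚ·π²`
(`ζ(2) = π²/6`). [folklore] -/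
theorem exists_rat_eval_of_mem_closure_two {c : FormalRep}
    (hc : c ∈ AddSubgroup.closure (genSetAdm 2)) : ∃ q : ℚ, eval c = q * Real.pi ^ 2 := by
  induction hc using AddSubgroup.closure_induction with
  | mem x hx =>
    obtain ⟨ε, q, s, hε, hd, hi, rfl⟩ := hx
    have h1 : s.value = (wordRep ε q hε).value := by
      have h := relations_le_ker_eval_holds (of_sub_of_wordRep_mem_relations hε s hd hi)
      rwa [AddMonoidHom.mem_ker, map_sub, sub_eq_zero, eval_of, eval_of] at h
    rw [eval_of, h1, value_wordRep]
    obtain rfl := adm_two_eq hε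
    exact ⟨q / 6, by rw [value_ω2]; push_cast; ring⟩
  | zero => exact ⟨0, by simp⟩
  | add x y _ _ hx hy =>
    obtain ⟨p, hp⟩ := hx
    obtain ⟨q, hq⟩ := hy
    exact ⟨p + q, by rw [map_add, hp, hq]; push_cast; ring⟩
  | neg x _ hx =>
    obtain ⟨p, hp⟩ := hx
    exact ⟨-p, by rw [map_neg, hp]; push_cast; ring⟩

/-! ## §3 The `H₁` adapter: `LemniscaticSectorKernel` is kernel form on `closure lemGen` -/

/-- **`H₁` adapter.** The route's rank-0 target (stated for `Fintype`-indexed `ℤ`-combinations of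
lemniscatic monomial representations) gives Conjecture 1 in kernel form on the subgroup generated by all
such representations: an element of the closure has class `ψ(P)` in the formal period ring for some
`P ∈ ℤ[x,y,z]` (`ψ = aeval (⟦k⟧, ⟦e⟧, ⟦p⟧)`), and `ψ(P)` is also the class of the `P.support`-indexed
combination of CANONICAL monomial representations, to which `H₁` applies. [folklore] -/
theorem kernelOn_lem_of_lsk (h1 : LemniscaticSectorKernel) :
    ∀ c ∈ AddSubgroup.closure lemGen, eval c = 0 → c ∈ relations := by
  obtain ⟨p, hpd, hpi⟩ := exists_piRep
  choose m hmd hmi hmP using fun a b c => exists_monoRep p hpd hpi a b c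
  intro c hc hc0
  -- (A) every element of the closure has a polynomial class
  have hP : ∃ P : MvPolynomial (Fin 3) ℤ, toFormalPeriod c =
      aeval ![toFormalPeriod (of kRep), toFormalPeriod (of eRep), toFormalPeriod (of p)] P := by
    clear hc0
    induction hc using AddSubgroup.closure_induction with
    | mem x hx =>
      obtain ⟨a, b, c', r, hrd, hri, rfl⟩ := hx
      refine ⟨X 0 ^ a * X 1 ^ b * X 2 ^ c', ?_⟩
      have hEq : Equivalent r (m a b c') :=
        equivalent_of_eqOn r _ (by rw [hmd, hrd]) (by rw [hmi]; exact hri)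
      rw [hEq.toFormalPeriod_eq, hmP]
      simp only [map_mul, map_pow, MvPolynomial.aeval_X]
      rfl
    | zero => exact ⟨0, by simp⟩
    | add x y _ _ hx hy =>
      obtain ⟨P, hP⟩ := hx
      obtain ⟨Q, hQ⟩ := hy
      exact ⟨P + Q, by rw [map_add, map_add, hP, hQ]⟩
    | neg x _ hx =>
      obtain ⟨P, hP⟩ := hx
      exact ⟨-P, by rw [map_neg, map_neg, hP]⟩
  obtain ⟨P, hP⟩ := hP
  -- (B) the `H₁`-shaped combination of canonical monomial representations with the same class
  have hsum : toFormalPeriod (∑ v : P.support, P.coeff v.1 • of (m (v.1 0) (v.1 1) (v.1 2))) =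
      aeval ![toFormalPeriod (of kRep), toFormalPeriod (of eRep), toFormalPeriod (of p)] P := by
    conv_rhs => rw [P.as_sum]
    rw [map_sum, map_sum, ← Finset.sum_coe_sort P.support]
    refine Finset.sum_congr rfl fun v _ => ?_
    rw [map_zsmul, hmP, MvPolynomial.aeval_monomial, Finsupp.prod_pow, Fin.prod_univ_three,
      zsmul_eq_mul, ← eq_intCast (algebraMap ℤ FormalPeriodRing)]
    rfl
  have hrel : (∑ v : P.support, P.coeff v.1 • of (m (v.1 0) (v.1 1) (v.1 2))) ∈ relations := by
    refine h1 P.support (fun v => P.coeff v.1) (fun v => v.1 0) (fun v => v.1 1) (fun v => v.1 2)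
      (fun v => m (v.1 0) (v.1 1) (v.1 2)) (fun v => hmd _ _ _)
      (fun v => by rw [hmi]; exact fun _ _ => rfl) ?_
    rw [← evalP_toFormalPeriod, hsum, ← hP, evalP_toFormalPeriod, hc0]
  rw [← toFormalPeriod_eq_zero_iff, hP, ← hsum, toFormalPeriod_eq_zero_iff]
  exact hrel

/-! ## §4 The two Euler CROSS relations (registered stubs) -/

/-- STUB (registered `stub_eulerCross4`): **Euler's `π⁴ = 90·ζ(4)` as a move chain across the
junction** — the lemniscatic monomial representation of type `(0,0,4)`, `[ℝ⁴, ∏ⱼ 1/(1+xⱼ²)]` (value `π⁴`),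
is congruent to `90·[Δ₄, ω₀₀₀₁]`. Assembly of landed chains: `[ℝ, 1/(1+t²)] ≡ 4·[(0,1), 1/(1+t²)]`
(`line_univ_sub_four_mem`), `Q ≡ 2·[(0,1), 1/(1+t²)]` (`Qrep_sub_two_line_mem`), Fubini `Q⁴ = G4`,
`45·[C4] ≡ 8·[G4]` (`fortyfive_C4_sub_eight_G4_mem`), `[C4] ≡ [Δ₄, ω₀₀₀₁]` (cubical chart). -/
theorem stub_eulerCross4 :
    ∀ (p : Literature.NumberTheory.Transcendental.KZ.IntegralRep ((0 + 0) + 4)),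
      p.domain = {x | ∀ j : Fin (0 + 0), x (Fin.castAdd 4 j) ∈ Set.Ioo (0:ℝ) 1} →
      Set.EqOn p.integrand (fun x =>
        (∏ j : Fin 0, (1 / Real.sqrt ((1 - x (Fin.castAdd 4 (Fin.castAdd 0 j)) ^ 2) *
          (1 - x (Fin.castAdd 4 (Fin.castAdd 0 j)) ^ 2 / 2)))) *
        (∏ j : Fin 0, (Real.sqrt (1 - x (Fin.castAdd 4 (Fin.natAdd 0 j)) ^ 2 / 2) /
          Real.sqrt (1 - x (Fin.castAdd 4 (Fin.natAdd 0 j)) ^ 2))) *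
        ∏ j : Fin 4, (1 / (1 + x (Fin.natAdd (0 + 0) j) ^ 2))) p.domain →
      90 • Literature.NumberTheory.Transcendental.KZ.of
          (Summit.KontsevichZagierPeriods.MzvKernelInKZ.Negative.wordRep
            Summit.KontsevichZagierPeriods.MzvKernelInKZ.Negative.ω4 1
            Summit.KontsevichZagierPeriods.MzvKernelInKZ.Negative.adm_ω4) -
        Literature.NumberTheory.Transcendental.KZ.of p ∈
        Literature.NumberTheory.Transcendental.KZ.relations := by
  sorry

/-- STUB (registered `stub_eulerCross2`): **Euler's `π² = 6·ζ(2)` across the junction** — the type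
`(0,0,2)` representation `[ℝ², ∏ⱼ 1/(1+xⱼ²)]` (value `π²`) is congruent to `6·[Δ₂, ω₀₁]`
(`line_univ_sub_four_mem`, `Qrep_sub_two_line_mem`, `Q² = G2`, `3·[Δ₂,ω₀₁] ≡ 2·[G2]`). -/
theorem stub_eulerCross2 :
    ∀ (p : Literature.NumberTheory.Transcendental.KZ.IntegralRep ((0 + 0) + 2)),
      p.domain = {x | ∀ j : Fin (0 + 0), x (Fin.castAdd 2 j) ∈ Set.Ioo (0:ℝ) 1} →
      Set.EqOn p.integrand (fun x =>
        (∏ j : Fin 0, (1 / Real.sqrt ((1 - x (Fin.castAdd 2 (Fin.castAdd 0 j)) ^ 2) *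
          (1 - x (Fin.castAdd 2 (Fin.castAdd 0 j)) ^ 2 / 2)))) *
        (∏ j : Fin 0, (Real.sqrt (1 - x (Fin.castAdd 2 (Fin.natAdd 0 j)) ^ 2 / 2) /
          Real.sqrt (1 - x (Fin.castAdd 2 (Fin.natAdd 0 j)) ^ 2))) *
        ∏ j : Fin 2, (1 / (1 + x (Fin.natAdd (0 + 0) j) ^ 2))) p.domain →
      6 • Literature.NumberTheory.Transcendental.KZ.of
          (Summit.KontsevichZagierPeriods.MzvKernelInKZ.Negative.wordRep
            Summit.KontsevichZagierPeriods.MzvKernelInKZ.Negative.ω2 1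
            Summit.KontsevichZagierPeriods.MzvKernelInKZ.Negative.adm_ω2) -
        Literature.NumberTheory.Transcendental.KZ.of p ∈
        Literature.NumberTheory.Transcendental.KZ.relations := by
  sorry

/-! ## §5 The joins (glue, proved from §§1–4) -/

/-- The canonical lemniscatic monomial representation of type `(0,0,k)` has value `πᵏ`. [folklore] -/
theorem value_monoRep_pi (p : IntegralRep 1) (hpd : p.domain = univ)
    (hpi : p.integrand = fun x => 1 / (1 + x 0 ^ 2)) {k : ℕ} (m : IntegralRep (0 + 0 + k))
    (hmP : toFormalPeriod (of m) =
      toFormalPeriod (of kRep) ^ 0 * toFormalPeriod (of eRep) ^ 0 * toFormalPeriod (of p) ^ k) :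
    eval (of m) = Real.pi ^ k := by
  rw [← evalP_toFormalPeriod, hmP, map_mul, map_mul, map_pow, map_pow, map_pow,
    evalP_toFormalPeriod, evalP_toFormalPeriod, evalP_toFormalPeriod, eval_of, eval_of, eval_of,
    piRep_value p hpd hpi]
  ring

/-- **JOIN, weight 4**: `H₁` and the Euler cross relation `π⁴ = 90ζ(4)` give kernel form on
`closure lemGen ⊔ closure (genSetAdm 4)` — the first non-idle use of the crux's hypothesis; the
cross-sector content is the value inclusion `ℚπ⁴ ⊆ values of ℤ[π]` and ONE transfer. [folklore] -/
theorem kernelOn_join4 (h1 : LemniscaticSectorKernel)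
    (hE4 : ∀ (q : IntegralRep ((0 + 0) + 4)),
      q.domain = {x | ∀ j : Fin (0 + 0), x (Fin.castAdd 4 j) ∈ Set.Ioo (0:ℝ) 1} →
      Set.EqOn q.integrand (fun x =>
        (∏ j : Fin 0, (1 / Real.sqrt ((1 - x (Fin.castAdd 4 (Fin.castAdd 0 j)) ^ 2) *
          (1 - x (Fin.castAdd 4 (Fin.castAdd 0 j)) ^ 2 / 2)))) *
        (∏ j : Fin 0, (Real.sqrt (1 - x (Fin.castAdd 4 (Fin.natAdd 0 j)) ^ 2 / 2) /
          Real.sqrt (1 - x (Fin.castAdd 4 (Fin.natAdd 0 j)) ^ 2))) *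
        ∏ j : Fin 4, (1 / (1 + x (Fin.natAdd (0 + 0) j) ^ 2))) q.domain →
      90 • of (wordRep ω4 1 adm_ω4) - of q ∈ relations) :
    ∀ c ∈ AddSubgroup.closure lemGen ⊔ AddSubgroup.closure (genSetAdm 4),
      eval c = 0 → c ∈ relations := by
  obtain ⟨p, hpd, hpi⟩ := exists_piRep
  obtain ⟨m, hmd, hmi, hmP⟩ := exists_monoRep p hpd hpi 0 0 4
  have hm_mem : of m ∈ AddSubgroup.closure lemGen :=
    AddSubgroup.subset_closure ⟨0, 0, 4, m, hmd, fun x _ => by rw [hmi], rfl⟩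
  have hm_val : eval (of m) = Real.pi ^ 4 := value_monoRep_pi p hpd hpi m hmP
  have hcross : of m - 90 • of (wordRep ω4 1 adm_ω4) ∈ relations := by
    have h := hE4 m hmd (fun x _ => by rw [hmi])
    simpa using relations.neg_mem h
  refine kernelOn_sup (kernelOn_lem_of_lsk h1) (weightKernelAdm_of_weightKernel weightKernel_four)
    fun a _ b hb hab => ?_
  obtain ⟨q, hq⟩ := exists_rat_eval_of_mem_closure_four hb
  refine ⟨q.den, -q.num, of m, 90 • of (wordRep ω4 1 adm_ω4), q.den_pos, hm_mem,
    AddSubgroup.nsmul_mem _ (AddSubgroup.subset_closure (of_wordRep_mem_genSetAdm _ _ _)) 90,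
    hcross, ?_⟩
  have ha : eval a = -(q * Real.pi ^ 4) := by linear_combination hab - hq
  rw [hm_val, ha, Int.cast_neg]
  have hnd : (q : ℝ) * q.den = q.num := by exact_mod_cast Rat.mul_den_eq_num q
  linear_combination -(Real.pi ^ 4) * hnd

/-- **JOIN, weights 4 and 2**: adding the weight-2 words (values `ℚπ²`) by the cross relation
`π² = 6ζ(2)`. [folklore] -/
theorem kernelOn_join42 (h1 : LemniscaticSectorKernel)
    (hE4 : ∀ (q : IntegralRep ((0 + 0) + 4)),
      q.domain = {x | ∀ j : Fin (0 + 0), x (Fin.castAdd 4 j) ∈ Set.Ioo (0:ℝ) 1} →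
      Set.EqOn q.integrand (fun x =>
        (∏ j : Fin 0, (1 / Real.sqrt ((1 - x (Fin.castAdd 4 (Fin.castAdd 0 j)) ^ 2) *
          (1 - x (Fin.castAdd 4 (Fin.castAdd 0 j)) ^ 2 / 2)))) *
        (∏ j : Fin 0, (Real.sqrt (1 - x (Fin.castAdd 4 (Fin.natAdd 0 j)) ^ 2 / 2) /
          Real.sqrt (1 - x (Fin.castAdd 4 (Fin.natAdd 0 j)) ^ 2))) *
        ∏ j : Fin 4, (1 / (1 + x (Fin.natAdd (0 + 0) j) ^ 2))) q.domain →
      90 • of (wordRep ω4 1 adm_ω4) - of q ∈ relations)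
    (hE2 : ∀ (q : IntegralRep ((0 + 0) + 2)),
      q.domain = {x | ∀ j : Fin (0 + 0), x (Fin.castAdd 2 j) ∈ Set.Ioo (0:ℝ) 1} →
      Set.EqOn q.integrand (fun x =>
        (∏ j : Fin 0, (1 / Real.sqrt ((1 - x (Fin.castAdd 2 (Fin.castAdd 0 j)) ^ 2) *
          (1 - x (Fin.castAdd 2 (Fin.castAdd 0 j)) ^ 2 / 2)))) *
        (∏ j : Fin 0, (Real.sqrt (1 - x (Fin.castAdd 2 (Fin.natAdd 0 j)) ^ 2 / 2) /
          Real.sqrt (1 - x (Fin.castAdd 2 (Fin.natAdd 0 j)) ^ 2))) *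
        ∏ j : Fin 2, (1 / (1 + x (Fin.natAdd (0 + 0) j) ^ 2))) q.domain →
      6 • of (wordRep ω2 1 adm_ω2) - of q ∈ relations) :
    ∀ c ∈ (AddSubgroup.closure lemGen ⊔ AddSubgroup.closure (genSetAdm 4)) ⊔
        AddSubgroup.closure (genSetAdm 2), eval c = 0 → c ∈ relations := by
  obtain ⟨p, hpd, hpi⟩ := exists_piRep
  obtain ⟨m, hmd, hmi, hmP⟩ := exists_monoRep p hpd hpi 0 0 2
  have hm_mem : of m ∈ AddSubgroup.closure lemGen ⊔ AddSubgroup.closure (genSetAdm 4) :=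
    AddSubgroup.mem_sup_left (AddSubgroup.subset_closure ⟨0, 0, 2, m, hmd, fun x _ => by rw [hmi], rfl⟩)
  have hm_val : eval (of m) = Real.pi ^ 2 := value_monoRep_pi p hpd hpi m hmP
  have hcross : of m - 6 • of (wordRep ω2 1 adm_ω2) ∈ relations := by
    have h := hE2 m hmd (fun x _ => by rw [hmi])
    simpa using relations.neg_mem h
  refine kernelOn_sup (kernelOn_join4 h1 hE4) weightKernelAdm_two fun a _ b hb hab => ?_
  obtain ⟨q, hq⟩ := exists_rat_eval_of_mem_closure_two hb
  refine ⟨q.den, -q.num, of m, 6 • of (wordRep ω2 1 adm_ω2), q.den_pos, hm_mem,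
    AddSubgroup.nsmul_mem _ (AddSubgroup.subset_closure (of_wordRep_mem_genSetAdm _ _ _)) 6,
    hcross, ?_⟩
  have ha : eval a = -(q * Real.pi ^ 2) := by linear_combination hab - hq
  rw [hm_val, ha, Int.cast_neg]
  have hnd : (q : ℝ) * q.den = q.num := by exact_mod_cast Rat.mul_den_eq_num q
  linear_combination -(Real.pi ^ 2) * hnd

/-- **The joint kernel from the two cross relations** (glue, proved): `H₁` propagates along the
`π`-line to the join of the lemniscatic sector with the MZV words of weights 4 and 2. [folklore] -/
theorem jointKernel_of_crosses
    (hE4 : ∀ (q : IntegralRep ((0 + 0) + 4)),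
      q.domain = {x | ∀ j : Fin (0 + 0), x (Fin.castAdd 4 j) ∈ Set.Ioo (0:ℝ) 1} →
      Set.EqOn q.integrand (fun x =>
        (∏ j : Fin 0, (1 / Real.sqrt ((1 - x (Fin.castAdd 4 (Fin.castAdd 0 j)) ^ 2) *
          (1 - x (Fin.castAdd 4 (Fin.castAdd 0 j)) ^ 2 / 2)))) *
        (∏ j : Fin 0, (Real.sqrt (1 - x (Fin.castAdd 4 (Fin.natAdd 0 j)) ^ 2 / 2) /
          Real.sqrt (1 - x (Fin.castAdd 4 (Fin.natAdd 0 j)) ^ 2))) *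
        ∏ j : Fin 4, (1 / (1 + x (Fin.natAdd (0 + 0) j) ^ 2))) q.domain →
      90 • of (wordRep ω4 1 adm_ω4) - of q ∈ relations)
    (hE2 : ∀ (q : IntegralRep ((0 + 0) + 2)),
      q.domain = {x | ∀ j : Fin (0 + 0), x (Fin.castAdd 2 j) ∈ Set.Ioo (0:ℝ) 1} →
      Set.EqOn q.integrand (fun x =>
        (∏ j : Fin 0, (1 / Real.sqrt ((1 - x (Fin.castAdd 2 (Fin.castAdd 0 j)) ^ 2) *
          (1 - x (Fin.castAdd 2 (Fin.castAdd 0 j)) ^ 2 / 2)))) *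
        (∏ j : Fin 0, (Real.sqrt (1 - x (Fin.castAdd 2 (Fin.natAdd 0 j)) ^ 2 / 2) /
          Real.sqrt (1 - x (Fin.castAdd 2 (Fin.natAdd 0 j)) ^ 2))) *
        ∏ j : Fin 2, (1 / (1 + x (Fin.natAdd (0 + 0) j) ^ 2))) q.domain →
      6 • of (wordRep ω2 1 adm_ω2) - of q ∈ relations)
    (h1 : LemniscaticSectorKernel) :
    ∀ c ∈ (AddSubgroup.closure lemGen ⊔ AddSubgroup.closure (genSetAdm 4)) ⊔
        AddSubgroup.closure (genSetAdm 2), eval c = 0 → c ∈ relations :=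
  kernelOn_join42 h1 hE4 hE2

/-- STUB (registered `stub_jointKernel`, the line's main UNCONDITIONAL deliverable and the landing
vehicle of the glue §§1–5): **`H₁` implies Conjecture 1 in kernel form on the join**
`closure lemGen ⊔ closure (genSetAdm 4) ⊔ closure (genSetAdm 2)`. Its landed proof is
`jointKernel_of_crosses stub_eulerCross4 stub_eulerCross2` (this file, sorry-free glue). -/
theorem stub_jointKernel :
    LemniscaticSectorKernel →
      ∀ c ∈ (AddSubgroup.closure lemGen ⊔ AddSubgroup.closure (genSetAdm 4)) ⊔
        AddSubgroup.closure (genSetAdm 2), eval c = 0 → c ∈ relations := by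
  sorry

/-! ## §6 The declared remainder (summit-strength, NOT CLAIMED) -/

/-- STUB (declared remainder, reshaped `stub_complementOfJoin`): Conjecture 1 off the join — kernel
form on `closure lemGen ⊔ closure (genSetAdm 4) ⊔ closure (genSetAdm 2)` implies the Statement. This
is summit-strength (Disproof.lean `crux_iff_summit_of`); nobody is expected to prove it. -/
theorem stub_complementOfJoin :
    (∀ c ∈ (AddSubgroup.closure lemGen ⊔ AddSubgroup.closure (genSetAdm 4)) ⊔
        AddSubgroup.closure (genSetAdm 2), eval c = 0 → c ∈ relations) →
      KontsevichZagierPeriods := by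
  sorry

/-! ## §7 Composition -/

/-- **The crux by name, modulo the stubs**: `H₁` propagates along the `π`-line to the join (§5), and
the declared remainder concludes the Statement; `H₂` is idle (it is a tree theorem:
`cFds4_mem_relations` + `GpcZeta4Eq4zeta31.Negative.crux_iff_target`). -/
theorem SectorComplement_of : SectorComplement := fun h1 _ =>
  stub_complementOfJoin (jointKernel_of_crosses stub_eulerCross4 stub_eulerCross2 h1)

/-- The same composition through the registered joint-kernel stub (its landed form). -/
theorem SectorComplement_of' : SectorComplement := fun h1 _ =>
  stub_complementOfJoin (stub_jointKernel h1)

/-! ## §5b The first odd-weight junction, priced (conditional on an OPEN disjointness) -/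

/-- Every formal combination of admissible weight-3 word representations has value in `ℚ·ζ(3)`
(`ζ(3)`, `ζ(2,1) = ζ(3)`). [folklore] -/
theorem exists_rat_eval_of_mem_closure_three {c : FormalRep}
    (hc : c ∈ AddSubgroup.closure (genSetAdm 3)) : ∃ q : ℚ, eval c = q * multipleZeta [3] := by
  induction hc using AddSubgroup.closure_induction with
  | mem x hx =>
    obtain ⟨ε, q, s, hε, hd, hi, rfl⟩ := hx
    have h1 : s.value = (wordRep ε q hε).value := by
      have h := relations_le_ker_eval_holds (of_sub_of_wordRep_mem_relations hε s hd hi)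
      rwa [AddMonoidHom.mem_ker, map_sub, sub_eq_zero, eval_of, eval_of] at h
    rw [eval_of, h1, value_wordRep]
    rcases adm_three_cases hε with rfl | rfl
    · exact ⟨q, by rw [value_ω3]⟩
    · exact ⟨q, by rw [value_ω21]⟩
  | zero => exact ⟨0, by simp⟩
  | add x y _ _ hx hy =>
    obtain ⟨p, hp⟩ := hx
    obtain ⟨q, hq⟩ := hy
    exact ⟨p + q, by rw [map_add, hp, hq]; push_cast; ring⟩
  | neg x _ hx =>
    obtain ⟨p, hp⟩ := hx
    exact ⟨-p, by rw [map_neg, hp]; push_cast; ring⟩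

/-- **THE WEIGHT-3 JUNCTION, PRICED.** Adjoining the weight-3 words (`ζ(3)`) to the join costs exactly
ONE statement, and it is a transcendence statement, not a rules statement: the `ℚ`-linear disjointness
of `ζ(3)` from the values of the join (which forces `ζ(3)/π³ ∉ ℚ` — OPEN). Given it, the amalgamation
degenerates (all cross values vanish) and kernel form extends by the landed rung
`weightKernelAdm_three`. This is where transcendence first enters the Grothendieck splice; the
hypothesis `hD` is the planner's `stub_zeta3Disjoint`, deliberately NOT claimed. [folklore] -/
theorem kernelOn_join423_of_disjoint (h1 : LemniscaticSectorKernel)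
    (hE4 : ∀ (q : IntegralRep ((0 + 0) + 4)),
      q.domain = {x | ∀ j : Fin (0 + 0), x (Fin.castAdd 4 j) ∈ Set.Ioo (0:ℝ) 1} →
      Set.EqOn q.integrand (fun x =>
        (∏ j : Fin 0, (1 / Real.sqrt ((1 - x (Fin.castAdd 4 (Fin.castAdd 0 j)) ^ 2) *
          (1 - x (Fin.castAdd 4 (Fin.castAdd 0 j)) ^ 2 / 2)))) *
        (∏ j : Fin 0, (Real.sqrt (1 - x (Fin.castAdd 4 (Fin.natAdd 0 j)) ^ 2 / 2) /
          Real.sqrt (1 - x (Fin.castAdd 4 (Fin.natAdd 0 j)) ^ 2))) *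
        ∏ j : Fin 4, (1 / (1 + x (Fin.natAdd (0 + 0) j) ^ 2))) q.domain →
      90 • of (wordRep ω4 1 adm_ω4) - of q ∈ relations)
    (hE2 : ∀ (q : IntegralRep ((0 + 0) + 2)),
      q.domain = {x | ∀ j : Fin (0 + 0), x (Fin.castAdd 2 j) ∈ Set.Ioo (0:ℝ) 1} →
      Set.EqOn q.integrand (fun x =>
        (∏ j : Fin 0, (1 / Real.sqrt ((1 - x (Fin.castAdd 2 (Fin.castAdd 0 j)) ^ 2) *
          (1 - x (Fin.castAdd 2 (Fin.castAdd 0 j)) ^ 2 / 2)))) *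
        (∏ j : Fin 0, (Real.sqrt (1 - x (Fin.castAdd 2 (Fin.natAdd 0 j)) ^ 2 / 2) /
          Real.sqrt (1 - x (Fin.castAdd 2 (Fin.natAdd 0 j)) ^ 2))) *
        ∏ j : Fin 2, (1 / (1 + x (Fin.natAdd (0 + 0) j) ^ 2))) q.domain →
      6 • of (wordRep ω2 1 adm_ω2) - of q ∈ relations)
    (hD : ∀ c ∈ (AddSubgroup.closure lemGen ⊔ AddSubgroup.closure (genSetAdm 4)) ⊔
        AddSubgroup.closure (genSetAdm 2), ∀ (u : ℤ) (v : ℕ), v ≠ 0 →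
        (v : ℝ) * eval c = (u : ℝ) * multipleZeta [3] → u = 0) :
    ∀ c ∈ ((AddSubgroup.closure lemGen ⊔ AddSubgroup.closure (genSetAdm 4)) ⊔
        AddSubgroup.closure (genSetAdm 2)) ⊔ AddSubgroup.closure (genSetAdm 3),
      eval c = 0 → c ∈ relations := by
  refine kernelOn_sup (kernelOn_join42 h1 hE4 hE2) weightKernelAdm_three fun a ha b hb hab => ?_
  obtain ⟨q, hq⟩ := exists_rat_eval_of_mem_closure_three hb
  have ha' : eval a = -(q * multipleZeta [3]) := by linear_combination hab - hq
  have hnd : (q : ℝ) * q.den = q.num := by exact_mod_cast Rat.mul_den_eq_num q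
  have hnum : -q.num = 0 := by
    refine hD a ha (-q.num) q.den q.den_nz ?_
    rw [ha', Int.cast_neg]
    linear_combination -(multipleZeta [3]) * hnd
  have hq0 : q = 0 := Rat.num_eq_zero.mp (neg_eq_zero.mp hnum)
  refine ⟨1, 0, 0, 0, one_pos, zero_mem _, zero_mem _, by rw [sub_zero]; exact zero_mem _, ?_⟩
  rw [ha', hq0]
  simp

/-! ## §8 Read-back for the planner: the remainder is EXACTLY the crux -/

/-- Converse of the adapter: kernel form on `closure lemGen` gives back `H₁` (a `Fintype`-indexed
`ℤ`-combination of lemniscatic monomial representations lies in the closure). [folklore] -/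
theorem lsk_of_kernelOn_lem
    (h : ∀ c ∈ AddSubgroup.closure lemGen, eval c = 0 → c ∈ relations) :
    LemniscaticSectorKernel := by
  intro ι _ z a' b' c' r' hdom hint h0
  have hmem : (∑ i, z i • of (r' i)) ∈ AddSubgroup.closure lemGen :=
    AddSubgroup.sum_mem _ fun i _ => AddSubgroup.zsmul_mem _
      (AddSubgroup.subset_closure
        (show of (r' i) ∈ lemGen from ⟨a' i, b' i, c' i, r' i, hdom i, hint i, rfl⟩)) (z i)
  exact h _ hmem h0

/-- `H₂ = GpcZeta4Eq4zeta31` is a tree theorem (finite double shuffle at weight 4: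
`cFds4_mem_relations`, read through `GpcZeta4Eq4zeta31.Negative.crux_iff_target`). [folklore] -/
theorem h2_holds : GpcZeta4Eq4zeta31 :=
  GpcZeta4Eq4zeta31.Negative.crux_iff_target.mpr cFds4_mem_relations

/-- **THE (RESHAPED) REMAINDER IS EQUIVALENT TO THE CRUX**: nothing is lost and nothing is gained by
the line — `stub_complementOfJoin ↔ SectorComplement` (using the joint kernel one way and the
converse adapter plus the theorem `H₂` the other). So the remainder is summit-strength exactly as the
crux is (`Disproof.crux_iff_summit_of`): modulo `H₁` both are `KontsevichZagierPeriods`. [folklore] -/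
theorem complementOfJoin_iff_crux :
    ((∀ c ∈ (AddSubgroup.closure lemGen ⊔ AddSubgroup.closure (genSetAdm 4)) ⊔
        AddSubgroup.closure (genSetAdm 2), eval c = 0 → c ∈ relations) → KontsevichZagierPeriods) ↔
      SectorComplement :=
  ⟨fun hrem h1 _ => hrem (stub_jointKernel h1),
   fun hcrux hJK => hcrux (lsk_of_kernelOn_lem fun c hc h0 =>
      hJK c (AddSubgroup.mem_sup_left (AddSubgroup.mem_sup_left hc)) h0) h2_holds⟩

/-- In particular, given `H₁`, the remainder IS the Statement. [folklore] -/
theorem complementOfJoin_iff_summit_of (h1 : LemniscaticSectorKernel) :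
    ((∀ c ∈ (AddSubgroup.closure lemGen ⊔ AddSubgroup.closure (genSetAdm 4)) ⊔
        AddSubgroup.closure (genSetAdm 2), eval c = 0 → c ∈ relations) → KontsevichZagierPeriods) ↔
      KontsevichZagierPeriods :=
  ⟨fun hrem => hrem (stub_jointKernel h1), fun hs _ => hs⟩

end Summit.KontsevichZagierPeriods.Grothendieck.SectorComplementAmalgamation

end
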